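import Literature.AlgebraicGeometry.Resolution.KnafKuhlmann2009Assembly
import Mathlib.RingTheory.Unramified.Field
import Mathlib.RingTheory.Kaehler.Basic
import Mathlib.Algebra.CharP.IntermediateField
import Mathlib.Algebra.MvPolynomial.Expand
import Mathlib.RingTheory.AlgebraicIndependent.TranscendenceBasis
import Mathlib.RingTheory.AlgebraicIndependent.AlgebraicClosure
import HarnessLib

/-!
# Knaf–Kuhlmann 2009, Prop. 2.3 (transcendence bases of separable valued function fields) — PROVED

Topic: `Literature/AlgebraicGeometry/Resolution`. We PROVE the named fact
`KnafKuhlmann2009_Prop23` of `FiniteExtensionUniformization.lean`: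

> **Knaf–Kuhlmann 2009, Prop. 2.3.** "Let `(F|K, P)` be a valued function field and assume that
> `F|K` is separable. Then there exists a separating transcendence basis of `F|K` containing
> elements `x₁,…,x_ρ, y₁,…,y_τ` such that: • the images of `vx₁,…,vx_ρ` under the natural map
> `vF → vF/vK ⊗ ℚ` form a basis of the `ℚ`-vector space on the right side, • `y₁P,…,y_τP`
> form a transcendence basis of `FP|KP`."

(`KnafKuhlmann2009_Prop23_holds`), and feed it into the assembly of Thm. 1.2
(`KnafKuhlmann2009Assembly.lean`): `KnafKuhlmann2009_Thm12.of_parts'` and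
`KnafKuhlmann2009.of_parts'` now take only Knaf–Kuhlmann 2009, Thm. 1.1 and Knaf–Kuhlmann 2005,
Thm. 1.1 as hypotheses.

## The proof

The printed proof (KK09 pp. 8–9) modifies a given separating transcendence basis one element
at a time using the structure theory of valued RATIONAL function fields ([K4] = F.-V. Kuhlmann,
*Value groups, residue fields and bad places of rational function fields*, Lemma 2.6 there =
KK09 Lemma 2.6, via KK09 Lemma 2.7) and the additivity of `ρ` and `τ` in towers. We give a
different, self-contained proof of the same statement, by "maximal families + the differential
criterion":

1. (`exists_maximal_families`) Choose `x₁,…,x_ρ ∈ F^×` with values `ℤ`-independent modulo `vK`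
   and `y₁,…,y_τ ∈ F ∩ O_P` with residues algebraically independent over `KP`, both families of
   MAXIMAL size. Such maximal families exist because, by Knaf–Kuhlmann 2005, Thm. 2.1
   (`ValuationIndependence.lean`, here `algebraicIndependent_sumElim_of_valIndep`), `x ∪ y` is
   algebraically independent over `K`, so `ρ + τ ≤ trdeg(F|K)` (Abhyankar's inequality);
   maximality says exactly that the `vxᵢ` are a `ℚ`-basis of `(vF/vK) ⊗ ℚ` and the `yⱼP` a
   transcendence basis of `FP|KP`.
2. Characteristic `0` (`prop23_charZero`): extend `x ∪ y` to a transcendence basis by elements of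
   the given separating transcendence basis `t₀` (Mathlib's `exists_isTranscendenceBasis_between`);
   it is separating because `K(x, y, t)` is perfect.
3. Characteristic `p > 0`, `F ⊄ O_P` (`prop23_charP`). Let `t₀ = {b_k}` be a separating
   transcendence basis, `n = #t₀ = trdeg(F|K)`, and `e` an injection of the `ρ + τ ≤ n` indices
   of `(x, y)` into those of `t₀`. Replace `xᵢ` by `x'ᵢ := xᵢᵖ + wᵢᵖ b_{e(i)}` and `yⱼ` by
   `y'ⱼ := yⱼᵖ + w'ⱼᵖ b_{e(j)}` with `wᵢ, w'ⱼ ∈ F^×` of so large value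
   (`exists_valuation_pow_mul_lt`, using some `δ ∈ F` with `v δ > 0`) that `v x'ᵢ = p·vxᵢ` and
   `y'ⱼP = (yⱼP)ᵖ`; the maximality properties of step 1 persist (`isAlgebraic_adjoin_pow`,
   `MvPolynomial.expand`). Let `t` be the `b_k` with `k ∉ im e`. Since `d(aᵖ) = 0` in
   `Ω[F⁄K]`, `d x'ᵢ = wᵢᵖ · d b_{e(i)}` and `d y'ⱼ = w'ⱼᵖ · d b_{e(j)}` are unit multiples of the
   `d b_k`, so the differentials of the `n` elements `(x', y', t)` span `Ω[F⁄K]`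
   (`span_range_D_eq_top`: the `d b_k` span, as `F|K(t₀)` is separable algebraic, i.e. formally
   unramified). By the **differential criterion** (`isSeparable_adjoin_of_span_range_D_eq_top`,
   `isTranscendenceBasis_of_span_range_D_eq_top`: if `d c₁,…,d c_n` span `Ω[F⁄K]` then
   `Ω[F⁄K(c)] = 0`, so `F|K(c)` is formally unramified, hence separable algebraic by Mathlib's
   `Algebra.FormallyUnramified.iff_isSeparable`, and `n ≤ trdeg` elements over which `F` is
   algebraic form a transcendence basis), `(x', y', t)` is a separating transcendence basis.
4. Characteristic `p > 0`, `F ⊆ O_P` (`prop23_of_subset`): then `vF = vK = 0`, `ρ = 0`, the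
   residue map embeds `F`, and `y := t₀`, `t := ∅` works (`algebraicIndependent_residue_of_subset`,
   `isAlgebraic_residue_of_subset`).

The passage between the ambient rendering (subfields `K ≤ F` of `Ω`) and Mathlib's `K`-algebra
language (an intermediate field `M` of `Ω|K` with the same elements as `F`, in which Kähler
differentials and `Algebra.trdeg` live) is `exists_bridge`,
`isSeparable_adjoin_intermediateField`, `isSeparable_adjoin_of_intermediateField`.

## Main results (all proved; axioms `propext`, `Classical.choice`, `Quot.sound`)

* `span_range_D_eq_top`, `isSeparable_adjoin_of_span_range_D_eq_top`,
  `isTranscendenceBasis_of_span_range_D_eq_top` — the differential criterion for separating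
  transcendence bases (folklore; cf. Matsumura, *Commutative Ring Theory*, §26).
* `algebraicIndependent_sumElim_of_valIndep` — Knaf–Kuhlmann 2005, Thm. 2.1 as
  `AlgebraicIndependent K (Sum.elim x y)`.
* `exists_maximal_families` — maximal value-independent / residue-independent families.
* `prop23_of_subset`, `prop23_charZero`, `prop23_charP`, `KnafKuhlmann2009_Prop23_holds`.
* `KnafKuhlmann2009_Thm12.of_parts'`, `KnafKuhlmann2009.of_parts'` — the assembly of
  Knaf–Kuhlmann 2009, Thm. 1.2 and of the fact `KnafKuhlmann2009` with Prop. 2.3 discharged: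
  the remaining hypotheses are `KnafKuhlmann2009_Thm11` (KK09 Thm. 1.1) and
  `KnafKuhlmann2005_Thm11` (KK05 Thm. 1.1).

## Sources

* H. Knaf, F.-V. Kuhlmann, *Every place admits local uniformization in a finite extension of
  the function field*, Adv. Math. 221 (2009) 428–453 = arXiv:math/0702856, Prop. 2.3 and its
  proof (pp. 8–9 of arXiv v1). [cite: KnafKuhlmann2009, Prop. 2.3]
* H. Knaf, F.-V. Kuhlmann, *Abhyankar places admit local uniformization in any characteristic*,
  Ann. Sci. ÉNS 38 (2005) 833–846 = arXiv:math/0304159, Thm. 2.1 and inequality (1) of §2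
  (pp. 5–6 of the arXiv PDF). [cite: KnafKuhlmann2005, Thm. 2.1]
* Differential criterion / formally unramified field extensions: Mathlib
  (`Mathlib.RingTheory.Unramified.Field`, `Mathlib.RingTheory.Kaehler.Basic`).
-/

noncomputable section

namespace Literature.AlgebraicGeometry.Resolution

universe u v

open IsLocalRing KaehlerDifferential

/-! ## Part I. The differential criterion for separating transcendence bases -/

section Differential

variable {K : Type*} {M : Type v} [Field K] [Field M] [Algebra K M]

/-- If an `M`-submodule `N ⊆ Ω[M⁄K]` contains the differentials of the `bᵢ`, then it contains
the differential of every element of `K(b)` (Leibniz rule and `d(a⁻¹) = -a⁻² da`). [folklore] -/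
theorem D_mem_of_mem_adjoin {ι : Type*} (b : ι → M) (N : Submodule M (Ω[M⁄K]))
    (hb : ∀ i, D K M (b i) ∈ N) {e : M} (he : e ∈ IntermediateField.adjoin K (Set.range b)) :
    D K M e ∈ N := by
  rw [← IntermediateField.mem_toSubfield, IntermediateField.adjoin_toSubfield] at he
  refine Subfield.closure_induction (p := fun e _ => D K M e ∈ N) ?_ ?_ ?_ ?_ ?_ ?_ he
  · rintro x (⟨c, rfl⟩ | ⟨i, rfl⟩)
    · rw [Derivation.map_algebraMap]; exact N.zero_mem
    · exact hb i
  · rw [Derivation.map_one_eq_zero]; exact N.zero_mem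
  · intro x y _ _ hx hy; rw [map_add]; exact N.add_mem hx hy
  · intro x _ hx; rw [map_neg]; exact N.neg_mem hx
  · intro x _ hx; rw [Derivation.leibniz_inv]; exact N.smul_mem _ hx
  · intro x y _ _ hx hy; rw [Derivation.leibniz]; exact N.add_mem (N.smul_mem _ hy) (N.smul_mem _ hx)

/-- **`Ω[M⁄K]` is spanned by the differentials of a separating family** (the exact sequence
`M ⊗ Ω[K(b)⁄K] → Ω[M⁄K] → Ω[M⁄K(b)] → 0` and `Ω[M⁄K(b)] = 0` for `M|K(b)` separable algebraic,
i.e. formally unramified): if `M` is separable algebraic over `K(b)`, the `d bᵢ` span `Ω[M⁄K]`.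
[folklore] -/
theorem span_range_D_eq_top {ι : Type*} (b : ι → M)
    [Algebra.IsSeparable (IntermediateField.adjoin K (Set.range b)) M] :
    Submodule.span M (Set.range fun i => D K M (b i)) = ⊤ := by
  set E₀ := IntermediateField.adjoin K (Set.range b) with hE₀
  set N := Submodule.span M (Set.range fun i => D K M (b i)) with hN
  haveI : Algebra.FormallyUnramified E₀ M := Algebra.FormallyUnramified.of_isSeparable E₀ M
  have hE : ∀ e : E₀, D K M (e : M) ∈ N := fun e =>
    D_mem_of_mem_adjoin b N (fun i => Submodule.subset_span ⟨i, rfl⟩) e.2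
  have hmap : ∀ η : Ω[E₀⁄K], map K K E₀ M η ∈ N := by
    intro η
    have hη : η ∈ Submodule.span E₀ (Set.range (D K E₀)) := by
      rw [span_range_derivation]; trivial
    refine Submodule.span_induction ?_ ?_ ?_ ?_ hη
    · rintro _ ⟨e, rfl⟩
      rw [map_D]
      exact hE e
    · rw [map_zero]; exact N.zero_mem
    · intro _ _ _ _ h₁ h₂; rw [map_add]; exact N.add_mem h₁ h₂
    · intro e η _ h
      rw [map_smul, algebra_compatible_smul M e]
      exact N.smul_mem _ h
  rw [eq_top_iff]
  rintro ω -
  have hker : ω ∈ LinearMap.ker (map K E₀ M M) := by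
    rw [LinearMap.mem_ker]; exact Subsingleton.elim _ _
  rw [← range_mapBaseChange] at hker
  obtain ⟨τ, rfl⟩ := hker
  induction τ using TensorProduct.induction_on with
  | zero => rw [map_zero]; exact N.zero_mem
  | tmul m η => rw [mapBaseChange_tmul]; exact N.smul_mem m (hmap η)
  | add a a' ha ha' => rw [map_add]; exact N.add_mem ha ha'

/-- **Differential criterion for separability**: if `M|K` is essentially of finite type and
the differentials `d cᵢ` span `Ω[M⁄K]`, then `Ω[M⁄K(c)] = 0`, so `M` is formally unramified,
hence separable algebraic, over `K(c)` (Mathlib: `Algebra.FormallyUnramified.iff_isSeparable`).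
[folklore] -/
theorem isSeparable_adjoin_of_span_range_D_eq_top [Algebra.EssFiniteType K M] {ι : Type*}
    (c : ι → M) (hc : Submodule.span M (Set.range fun i => D K M (c i)) = ⊤) :
    Algebra.IsSeparable (IntermediateField.adjoin K (Set.range c)) M := by
  set E := IntermediateField.adjoin K (Set.range c) with hE
  haveI : Algebra.EssFiniteType E M := Algebra.EssFiniteType.of_comp K E M
  suffices Algebra.FormallyUnramified E M from Algebra.FormallyUnramified.isSeparable E M
  refine ⟨?_⟩
  have hzero : ∀ m : M, D E M m = 0 := by
    intro m
    have hm : D K M m ∈ Submodule.span M (Set.range fun i => D K M (c i)) := by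
      rw [hc]; trivial
    have himg : map K E M M (D K M m) = D E M m := by
      rw [map_D]; rfl
    rw [← himg]
    refine Submodule.span_induction ?_ ?_ ?_ ?_ hm
    · rintro _ ⟨i, rfl⟩
      rw [map_D]
      have : (algebraMap M M) (c i) =
          algebraMap E M ⟨c i, IntermediateField.subset_adjoin _ _ ⟨i, rfl⟩⟩ := rfl
      rw [this, Derivation.map_algebraMap]
    · rw [map_zero]
    · intro _ _ _ _ h₁ h₂; rw [map_add, h₁, h₂, add_zero]
    · intro a ω _ h; rw [map_smul, h, smul_zero]
  refine (subsingleton_iff_forall_eq 0).mpr fun ω => ?_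
  have hω : ω ∈ Submodule.span M (Set.range (D E M)) := by
    rw [span_range_derivation]; trivial
  refine Submodule.span_induction ?_ rfl ?_ ?_ hω
  · rintro _ ⟨m, rfl⟩; exact hzero m
  · intro _ _ _ _ h₁ h₂; rw [h₁, h₂, add_zero]
  · intro a ω _ h; rw [h, smul_zero]

/-- **Differential criterion for separating transcendence bases**: a family `c` of at most
`trdeg(M|K)` elements of `M` (`M|K` essentially of finite type) whose differentials span
`Ω[M⁄K]` is a transcendence basis of `M|K` (and `M|K(c)` is separable, by
`isSeparable_adjoin_of_span_range_D_eq_top`). [folklore] -/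
theorem isTranscendenceBasis_of_span_range_D_eq_top [Algebra.EssFiniteType K M] {ι : Type*}
    [Finite ι] (c : ι → M) (hc : Submodule.span M (Set.range fun i => D K M (c i)) = ⊤)
    (hle : Cardinal.lift.{v} (Cardinal.mk ι) ≤ Cardinal.lift (Algebra.trdeg K M)) :
    IsTranscendenceBasis K c := by
  haveI := isSeparable_adjoin_of_span_range_D_eq_top c hc
  haveI : Algebra.IsAlgebraic (IntermediateField.adjoin K (Set.range c)) M :=
    Algebra.IsSeparable.isAlgebraic _ _
  haveI : Algebra.IsAlgebraic (Algebra.adjoin K (Set.range c)) M :=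
    IntermediateField.isAlgebraic_adjoin_iff_top.mp inferInstance
  exact Algebra.IsAlgebraic.isTranscendenceBasis_of_lift_le_trdeg_of_finite K c hle

/-- Algebraicity over `L(u)` implies algebraicity over `L(uⁿ)` (`n ≥ 1`): the `uᵢ` are integral
over `L(uⁿ)`. [folklore] -/
theorem isAlgebraic_adjoin_pow {L E : Type*} [Field L] [Field E] [Algebra L E] {ι : Type*}
    (u : ι → E) {n : ℕ} (hn : 0 < n) {r : E}
    (h : IsAlgebraic (IntermediateField.adjoin L (Set.range u)) r) :
    IsAlgebraic (IntermediateField.adjoin L (Set.range fun i => u i ^ n)) r := by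
  set S₁ := IntermediateField.adjoin L (Set.range fun i => u i ^ n) with hS₁
  set S₂ := IntermediateField.adjoin S₁ (Set.range u) with hS₂
  have hle : ∀ w : E, w ∈ IntermediateField.adjoin L (Set.range u) → w ∈ S₂ := by
    intro w hw
    have : IntermediateField.adjoin L (Set.range u) ≤ S₂.restrictScalars L :=
      IntermediateField.adjoin_le_iff.mpr fun z hz => IntermediateField.subset_adjoin S₁ _ hz
    exact this hw
  let f : IntermediateField.adjoin L (Set.range u) →+* S₂ :=
    { toFun := fun w => ⟨w, hle w w.2⟩
      map_one' := rfl
      map_mul' := fun _ _ => rfl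
      map_zero' := rfl
      map_add' := fun _ _ => rfl }
  have h2 : IsAlgebraic S₂ r := isAlgebraic_of_ringHom_comp_eq f (RingHom.ext fun _ => rfl) h
  haveI : Algebra.IsAlgebraic S₁ S₂ := by
    refine IntermediateField.isAlgebraic_adjoin fun w hw => ?_
    obtain ⟨i, rfl⟩ := hw
    refine IsIntegral.of_pow hn ?_
    have hmem : u i ^ n ∈ S₁ := IntermediateField.subset_adjoin L _ ⟨i, rfl⟩
    exact isIntegral_algebraMap (R := S₁) (x := (⟨u i ^ n, hmem⟩ : S₁))
  exact h2.restrictScalars S₁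

end Differential

/-! ## Part II. Valued function fields inside `(Ω, V)` -/

variable {Ω : Type u} [Field Ω]

section Ambient

variable (V : ValuationSubring Ω) (K : Subfield Ω)

/-- **Knaf–Kuhlmann 2005, Thm. 2.1** in Mathlib's form: `x, y` with values of the `xᵢ`
`ℤ`-independent modulo `vK` and residues of the `yⱼ` algebraically independent over `KP` are
algebraically independent over `K` (from the iterated-polynomial form `eval₂_eq_zero_imp` of
`ValuationIndependence.lean` via `K[X ⊔ Y] ≅ (K[Y])[X]`). [cite: KnafKuhlmann2005, Thm. 2.1] -/
theorem algebraicIndependent_sumElim_of_valIndep {ι κ : Type*} [Fintype ι] (x : ι → Ω) (y : κ → Ω)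
    (hx0 : ∀ i, x i ≠ 0)
    (hxi : ∀ m : ι → ℤ, (∃ b ∈ K, (∏ i, V.valuation (x i) ^ (m i)) = V.valuation b) → m = 0)
    (hy : ∀ j, y j ∈ V)
    (hri : AlgebraicIndependent (resField V K) (fun j => residue V ⟨y j, hy j⟩)) :
    AlgebraicIndependent K (Sum.elim x y) := by
  classical
  rw [algebraicIndependent_iff]
  intro q hq
  set e := MvPolynomial.sumRingEquiv K ι κ with he
  have key : ((MvPolynomial.eval₂Hom (MvPolynomial.aeval y).toRingHom x).comp e.toRingHom) =
      (MvPolynomial.aeval (Sum.elim x y)).toRingHom := by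
    apply MvPolynomial.ringHom_ext
    · intro c
      simp [he, MvPolynomial.sumRingEquiv_C]
    · rintro (i | j)
      · simp [he, MvPolynomial.sumRingEquiv_X_inl]
      · simp [he, MvPolynomial.sumRingEquiv_X_inr]
  have hq' : MvPolynomial.eval₂ (MvPolynomial.aeval y).toRingHom x (e q) = 0 := by
    have := RingHom.congr_fun key q
    simp only [RingHom.coe_comp, Function.comp_apply, MvPolynomial.coe_eval₂Hom] at this
    rw [← hq]
    exact this
  have h := eval₂_eq_zero_imp V K hx0 hxi hy hri (e q) hq'
  exact e.injective (by rw [h, map_zero])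

/-- A non-zero element of a subfield `F ⊆ V` is a unit of `V`: its value is `1`. [folklore] -/
theorem valuation_eq_one_of_subfield_subset {F : Subfield Ω} (hFV : ∀ z ∈ F, z ∈ V) {a : Ω}
    (haF : a ∈ F) (ha0 : a ≠ 0) : V.valuation a = 1 := by
  have h1 : V.valuation a ≤ 1 := (V.valuation_le_one_iff a).mpr (hFV a haF)
  have h2 : V.valuation a⁻¹ ≤ 1 := (V.valuation_le_one_iff _).mpr (hFV _ (inv_mem haF))
  rw [map_inv₀, inv_le_one₀ (zero_lt_iff.mpr ((map_ne_zero V.valuation).mpr ha0))] at h2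
  exact le_antisymm h1 h2

/-- **Residue maps on subfields of `O_V`.** For subfields `K ≤ F ⊆ V` there are ring
homomorphisms `K → KP` (onto `KP = resField V K`) and `F → FP ⊆ O_V/𝔪_V` given by the residue
map. [folklore] -/
theorem exists_residue_ringHoms {F : Subfield Ω} (hKF : K ≤ F) (hFV : ∀ z ∈ F, z ∈ V) :
    ∃ (φ : K →+* resField V K) (g : F →+* ResidueField V), Function.Surjective φ ∧
      (∀ c : K, (φ c : ResidueField V) = residue V ⟨c, hFV c (hKF c.2)⟩) ∧
      (∀ a : F, g a = residue V ⟨a, hFV a a.2⟩) := by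
  have hKV : ∀ c ∈ K, c ∈ V := fun c hc => hFV c (hKF hc)
  let φ : K →+* resField V K :=
    { toFun := fun c => ⟨residue V ⟨c, hKV c c.2⟩, residue_mem_resField V _ c.2⟩
      map_one' := Subtype.ext (by
        change residue V ⟨((1 : K) : Ω), _⟩ = 1
        rw [← map_one (residue V)]; rfl)
      map_mul' := fun a b => Subtype.ext (by
        change residue V ⟨(a : Ω) * b, _⟩ = residue V ⟨a, _⟩ * residue V ⟨b, _⟩
        rw [← map_mul]; rfl)
      map_zero' := Subtype.ext (by
        change residue V ⟨((0 : K) : Ω), _⟩ = 0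
        rw [← map_zero (residue V)]; rfl)
      map_add' := fun a b => Subtype.ext (by
        change residue V ⟨(a : Ω) + b, _⟩ = residue V ⟨a, _⟩ + residue V ⟨b, _⟩
        rw [← map_add]; rfl) }
  let g : F →+* ResidueField V :=
    { toFun := fun a => residue V ⟨a, hFV a a.2⟩
      map_one' := by
        change residue V ⟨((1 : F) : Ω), _⟩ = 1
        rw [← map_one (residue V)]; rfl
      map_mul' := fun a b => by
        change residue V ⟨(a : Ω) * b, _⟩ = residue V ⟨a, _⟩ * residue V ⟨b, _⟩
        rw [← map_mul]; rfl
      map_zero' := by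
        change residue V ⟨((0 : F) : Ω), _⟩ = 0
        rw [← map_zero (residue V)]; rfl
      map_add' := fun a b => by
        change residue V ⟨(a : Ω) + b, _⟩ = residue V ⟨a, _⟩ + residue V ⟨b, _⟩
        rw [← map_add]; rfl }
  refine ⟨φ, g, fun r => ?_, fun c => rfl, fun a => rfl⟩
  obtain ⟨a, haK, har⟩ := (mem_resField_iff V K r).mp r.2
  refine ⟨⟨a, haK⟩, Subtype.ext ?_⟩
  change residue V ⟨(a : Ω), _⟩ = (r : ResidueField V)
  rw [← har]

/-- **Trivially valued function fields, I**: if `F ⊆ V`, algebraic independence over `K ⊆ F`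
passes to the residues over `KP`. [folklore] -/
theorem algebraicIndependent_residue_of_subset {F : Subfield Ω} (hKF : K ≤ F)
    (hFV : ∀ z ∈ F, z ∈ V) {ι : Type*} (z : ι → Ω) (hz : ∀ i, z i ∈ F)
    (hind : AlgebraicIndependent K z) :
    AlgebraicIndependent (resField V K) (fun i => residue V ⟨z i, hFV _ (hz i)⟩) := by
  obtain ⟨φ, g, hφs, hφ, hg⟩ := exists_residue_ringHoms V K hKF hFV
  letI : Algebra K F := (Subfield.inclusion hKF).toAlgebra
  let zF : ι → F := fun i => ⟨z i, hz i⟩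
  let gA : F →ₐ[K] Ω := { F.subtype with commutes' := fun _ => rfl }
  have hzF : AlgebraicIndependent K zF := AlgebraicIndependent.of_comp gA hind
  have hcomp : (algebraMap (resField V K) (ResidueField V)).comp φ = g.comp (algebraMap K F) :=
    RingHom.ext fun c => by
      rw [RingHom.comp_apply, RingHom.comp_apply]
      exact (hφ c).trans (hg (algebraMap K F c)).symm
  have h := hzF.ringHom_of_comp_eq φ g hφs g.injective hcomp
  convert h using 1
  funext i
  exact (hg (zF i)).symm

/-- **Trivially valued function fields, II**: if `F ⊆ V` and `a ∈ F` is algebraic over `K(z)`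
(`z` algebraically independent elements of `F`), then `aP` is algebraic over `KP(zP)`.
[folklore] -/
theorem isAlgebraic_residue_of_subset {F : Subfield Ω} (hKF : K ≤ F)
    (hFV : ∀ z ∈ F, z ∈ V) {ι : Type*} (z : ι → Ω) (hz : ∀ i, z i ∈ F)
    (hind : AlgebraicIndependent K z) {a : Ω} (haF : a ∈ F)
    (halg : IsAlgebraic (IntermediateField.adjoin K (Set.range z)) a) :
    IsAlgebraic (IntermediateField.adjoin (resField V K)
      (Set.range fun i => residue V ⟨z i, hFV _ (hz i)⟩)) (residue V ⟨a, hFV a haF⟩) := by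
  obtain ⟨φ, g, -, hφ, hg⟩ := exists_residue_ringHoms V K hKF hFV
  letI : Algebra K F := (Subfield.inclusion hKF).toAlgebra
  let zF : ι → F := fun i => ⟨z i, hz i⟩
  let aF : F := ⟨a, haF⟩
  let gA : F →ₐ[K] Ω := { F.subtype with commutes' := fun _ => rfl }
  have hcomp : (algebraMap (resField V K) (ResidueField V)).comp φ = g.comp (algebraMap K F) :=
    RingHom.ext fun c => by
      rw [RingHom.comp_apply, RingHom.comp_apply]
      exact (hφ c).trans (hg (algebraMap K F c)).symm
  -- `(z, a)` is algebraically dependent over `K`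
  have hdep : ¬ AlgebraicIndependent K (fun o : Option ι => o.elim aF zF) := by
    intro h
    have h' : AlgebraicIndependent K (fun o : Option ι => o.elim a z) := by
      have := h.map' (f := gA) (fun a b hab => Subtype.ext hab)
      convert this using 1
      funext o; cases o <;> rfl
    rw [AlgebraicIndependent.option_iff] at h'
    exact h'.2 (IntermediateField.isAlgebraic_adjoin_iff.mp halg)
  -- hence so are the residues
  have hdep' : ¬ AlgebraicIndependent (resField V K)
      (fun o : Option ι => o.elim (residue V ⟨a, hFV a haF⟩)
        (fun i => residue V ⟨z i, hFV _ (hz i)⟩)) := by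
    intro h
    apply hdep
    refine AlgebraicIndependent.of_ringHom_of_comp_eq φ g ?_ φ.injective hcomp
    convert h using 1
    funext o
    cases o with
    | none => exact hg aF
    | some i => exact hg (zF i)
  rw [AlgebraicIndependent.option_iff, not_and] at hdep'
  have := hdep' (algebraicIndependent_residue_of_subset V K hKF hFV z hz hind)
  rw [IntermediateField.isAlgebraic_adjoin_iff]
  unfold Transcendental at this
  push Not at this
  exact this

/-- Small `p`-th powers: if `F` contains `δ ≠ 0` with `v(δ) < 1`, then for `β, θ ∈ F`,
`θ ≠ 0`, there is `w ∈ F`, `w ≠ 0`, with `v(wᵖ β) < v(θ)`. [folklore] -/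
theorem exists_valuation_pow_mul_lt {F : Subfield Ω} {δ : Ω} (hδF : δ ∈ F) (hδ0 : δ ≠ 0)
    (hδ : V.valuation δ < 1) (p : ℕ) (hp : p ≠ 0) {β θ : Ω} (hβ : β ∈ F) (hθ : θ ∈ F)
    (hθ0 : θ ≠ 0) : ∃ w ∈ F, w ≠ 0 ∧ V.valuation (w ^ p * β) < V.valuation θ := by
  have hvθ : 0 < V.valuation θ := zero_lt_iff.mpr ((map_ne_zero V.valuation).mpr hθ0)
  by_cases hβ0 : β = 0
  · exact ⟨1, F.one_mem, one_ne_zero, by simpa [hβ0] using hvθ⟩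
  have hvβ : 0 < V.valuation β := zero_lt_iff.mpr ((map_ne_zero V.valuation).mpr hβ0)
  set γ := θ / β with hγ
  have hγ0 : γ ≠ 0 := div_ne_zero hθ0 hβ0
  have hvγ : 0 < V.valuation γ := zero_lt_iff.mpr ((map_ne_zero V.valuation).mpr hγ0)
  have hp1 : 1 ≤ p := Nat.one_le_iff_ne_zero.mpr hp
  have key : ∃ w ∈ F, w ≠ 0 ∧ V.valuation (w ^ p) < V.valuation γ := by
    by_cases hle : V.valuation γ ≤ 1
    · refine ⟨δ * γ, mul_mem hδF (div_mem hθ hβ), mul_ne_zero hδ0 hγ0, ?_⟩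
      rw [mul_pow, map_mul, map_pow, map_pow]
      have h1 : V.valuation δ ^ p ≤ V.valuation δ := by
        simpa using pow_le_pow_right_of_le_one' hδ.le hp1
      have h2 : V.valuation γ ^ p ≤ V.valuation γ := by
        simpa using pow_le_pow_right_of_le_one' hle hp1
      calc V.valuation δ ^ p * V.valuation γ ^ p ≤ V.valuation δ * V.valuation γ :=
            mul_le_mul' h1 h2
        _ < 1 * V.valuation γ := mul_lt_mul_of_pos_right hδ hvγ
        _ = V.valuation γ := one_mul _
    · push Not at hle
      refine ⟨δ, hδF, hδ0, lt_of_le_of_lt ?_ hle⟩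
      rw [map_pow]
      exact pow_le_one' hδ.le p
  obtain ⟨w, hwF, hw0, hw⟩ := key
  refine ⟨w, hwF, hw0, ?_⟩
  rw [map_mul]
  rwa [hγ, map_div₀, lt_div_iff₀ hvβ] at hw

end Ambient

/-! ## Part III. The bridge between a subfield `F ⊆ Ω` and a `K`-algebra `M ≅ F` -/

section Bridge

variable {K : Subfield Ω}

/-- Separability over `K(b)` computed in `Ω` gives separability over `K(b)` computed in an
intermediate field `M ∋ bᵢ`. [folklore] -/
theorem isSeparable_adjoin_intermediateField (M : IntermediateField K Ω) {ι : Type*}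
    (b : ι → M) {m : M}
    (h : IsSeparable (IntermediateField.adjoin K (Set.range fun i => (b i : Ω))) (m : Ω)) :
    IsSeparable (IntermediateField.adjoin K (Set.range b)) m := by
  set A := IntermediateField.adjoin K (Set.range b) with hA
  have himage : Subtype.val '' Set.range b = Set.range fun i => (b i : Ω) := by
    rw [← Set.range_comp]; rfl
  have hmem : ∀ w : Ω, w ∈ IntermediateField.adjoin K (Set.range fun i => (b i : Ω)) →
      w ∈ IntermediateField.lift A := by
    intro w hw; rwa [IntermediateField.lift_adjoin, himage]
  let f : IntermediateField.adjoin K (Set.range fun i => (b i : Ω)) →+* A :=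
    { toFun := fun w => ⟨⟨w, IntermediateField.lift_le A (hmem w w.2)⟩,
        (IntermediateField.mem_lift _).mp (hmem w w.2)⟩
      map_one' := rfl
      map_mul' := fun _ _ => rfl
      map_zero' := rfl
      map_add' := fun _ _ => rfl }
  have h1 : IsSeparable A (m : Ω) := isSeparable_of_ringHom_comp_eq f (RingHom.ext fun _ => rfl) h
  have hmin := minpoly.algebraMap_eq (A := A) (algebraMap M Ω).injective m
  change (minpoly A m).Separable
  rw [← hmin]
  exact h1

/-- Conversely, separability over `K(c)` in `M` gives separability over `K(c)` in `Ω`.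
[folklore] -/
theorem isSeparable_adjoin_of_intermediateField (M : IntermediateField K Ω) {ι : Type*}
    (c : ι → M) {m : M} (h : IsSeparable (IntermediateField.adjoin K (Set.range c)) m) :
    IsSeparable (IntermediateField.adjoin K (Set.range fun i => (c i : Ω))) (m : Ω) := by
  set A := IntermediateField.adjoin K (Set.range c) with hA
  have himage : Subtype.val '' Set.range c = Set.range fun i => (c i : Ω) := by
    rw [← Set.range_comp]; rfl
  have hmem : ∀ w : A, ((w : M) : Ω) ∈ IntermediateField.adjoin K (Set.range fun i => (c i : Ω)) := by
    intro w
    have hw : ((w : M) : Ω) ∈ IntermediateField.lift A := (IntermediateField.mem_lift (w : M)).mpr w.2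
    rwa [IntermediateField.lift_adjoin, himage] at hw
  have hmin := minpoly.algebraMap_eq (A := A) (algebraMap M Ω).injective m
  have h1 : IsSeparable A (m : Ω) := by
    change (minpoly A (algebraMap M Ω m)).Separable
    rw [hmin]
    exact h
  let f : A →+* IntermediateField.adjoin K (Set.range fun i => (c i : Ω)) :=
    { toFun := fun w => ⟨((w : M) : Ω), hmem w⟩
      map_one' := rfl
      map_mul' := fun _ _ => rfl
      map_zero' := rfl
      map_add' := fun _ _ => rfl }
  exact isSeparable_of_ringHom_comp_eq f (RingHom.ext fun _ => rfl) h1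

/-- Separability over `K(S)` persists over `K(S')` for `S ⊆ S'`. [folklore] -/
theorem isSeparable_adjoin_of_subset {S S' : Set Ω} (h : S ⊆ S') {z : Ω}
    (hz : IsSeparable (IntermediateField.adjoin K S) z) :
    IsSeparable (IntermediateField.adjoin K S') z :=
  isSeparable_of_le (IntermediateField.adjoin.mono K S S' h) hz

/-- Algebraicity over `K(S)` persists over `K(S')` for `S ⊆ S'`. [folklore] -/
theorem isAlgebraic_adjoin_of_subset {S S' : Set Ω} (h : S ⊆ S') {z : Ω}
    (hz : IsAlgebraic (IntermediateField.adjoin K S) z) :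
    IsAlgebraic (IntermediateField.adjoin K S') z :=
  isAlgebraic_of_ringHom_comp_eq (IntermediateField.inclusion (IntermediateField.adjoin.mono K S S' h)).toRingHom
    (RingHom.ext fun _ => rfl) hz

/-- **The bridge.** For `F|K` finitely generated inside `Ω` with separating transcendence
basis `t₀`, an intermediate field `M` of `Ω|K` with the same elements as `F`, essentially of
finite type over `K`, in which `t₀` is a transcendence basis over which `M` is separable; in
particular `trdeg(M|K) = #t₀` bounds the size of every `K`-algebraically independent family
in `F`. [folklore] -/
theorem exists_bridge {F : Subfield Ω} (hfg : FGOver K F) {t₀ : Finset Ω}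
    (ht₀F : (t₀ : Set Ω) ⊆ F) (hind₀ : AlgebraicIndependent K ((↑) : t₀ → Ω))
    (hsep₀ : ∀ z ∈ F, IsSeparable (IntermediateField.adjoin K (t₀ : Set Ω)) z) :
    ∃ M : IntermediateField K Ω, (∀ z, z ∈ M ↔ z ∈ F) ∧ Algebra.EssFiniteType K M ∧
      ∃ b : t₀ → M, (∀ k, (b k : Ω) = k) ∧ IsTranscendenceBasis K b ∧
        (∀ m : M, IsSeparable (IntermediateField.adjoin K (Set.range b)) m) ∧
        Algebra.trdeg K M = t₀.card ∧
        (∀ n (z : Fin n → Ω), (∀ i, z i ∈ F) → AlgebraicIndependent K z → n ≤ t₀.card) := by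
  classical
  obtain ⟨s, hs⟩ := hfg
  set M : IntermediateField K Ω := IntermediateField.adjoin K (s : Set Ω) with hM
  have hMF : ∀ z : Ω, z ∈ M ↔ z ∈ F := fun z => by
    rw [hM, mem_adjoin_subfield_iff, hs]
  haveI hess : Algebra.EssFiniteType K M :=
    IntermediateField.essFiniteType_iff.mpr (IntermediateField.fg_adjoin_finset s)
  let b : t₀ → M := fun k => ⟨k, (hMF _).mpr (ht₀F k.2)⟩
  have hbind : AlgebraicIndependent K b := AlgebraicIndependent.of_comp M.val hind₀
  have hrange : Set.range (fun k : t₀ => (b k : Ω)) = (t₀ : Set Ω) := by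
    ext w; constructor
    · rintro ⟨k, rfl⟩; exact k.2
    · intro hw; exact ⟨⟨w, hw⟩, rfl⟩
  have hsepM : ∀ m : M, IsSeparable (IntermediateField.adjoin K (Set.range b)) m := by
    intro m
    apply isSeparable_adjoin_intermediateField M b
    exact isSeparable_adjoin_of_subset (hrange ▸ subset_rfl) (hsep₀ m ((hMF _).mp m.2))
  have hb : IsTranscendenceBasis K b := by
    refine hbind.isTranscendenceBasis_iff_isAlgebraic.mpr ?_
    exact IntermediateField.isAlgebraic_adjoin_iff_top.mp ⟨fun m => (hsepM m).isIntegral.isAlgebraic⟩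
  have htr : Algebra.trdeg K M = t₀.card := by
    rw [← hb.cardinalMk_eq_trdeg, Cardinal.mk_fintype, Fintype.card_coe]
  refine ⟨M, hMF, hess, b, fun k => rfl, hb, hsepM, htr, fun n z hzF hz => ?_⟩
  let zM : Fin n → M := fun i => ⟨z i, (hMF _).mpr (hzF i)⟩
  have hzM : AlgebraicIndependent K zM := AlgebraicIndependent.of_comp M.val hz
  have := hzM.lift_cardinalMk_le_trdeg
  rw [htr, Cardinal.mk_fintype, Fintype.card_fin, Cardinal.lift_natCast,
    Cardinal.lift_natCast] at this
  exact_mod_cast this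

end Bridge

/-! ## Part IV. Maximal value-independent and residue-independent families -/

section Maximal

variable (V : ValuationSubring Ω) {K F : Subfield Ω}

/-- **Maximal families.** If the `K`-algebraically independent families in `F` have bounded
size, there are `x₁,…,x_ρ ∈ F^×` with values `ℤ`-independent modulo `vK` and MAXIMAL (every
value of `F^×` has a positive multiple in `vK · ∏ v(xᵢ)^ℤ`, i.e. the `vxᵢ` are a `ℚ`-basis of
`(vF/vK) ⊗ ℚ`) and `y₁,…,y_τ ∈ F ∩ O_V` with residues algebraically independent over `KP` and
MAXIMAL (`FP` algebraic over `KP(yP)`, i.e. the `yⱼP` are a transcendence basis of `FP|KP`);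
by Knaf–Kuhlmann 2005, Thm. 2.1, `x, y` are algebraically independent over `K`, so `ρ + τ`
obeys the bound (Abhyankar's inequality). [cite: KnafKuhlmann2005, Thm. 2.1 and §2 (1)] -/
theorem exists_maximal_families (n : ℕ)
    (hbound : ∀ m (z : Fin m → Ω), (∀ i, z i ∈ F) → AlgebraicIndependent K z → m ≤ n) :
    ∃ (ρ τ : ℕ) (x : Fin ρ → Ω) (y : Fin τ → Ω) (hy : ∀ j, y j ∈ V),
      (∀ i, x i ∈ F ∧ x i ≠ 0) ∧ (∀ j, y j ∈ F) ∧
      (∀ m : Fin ρ → ℤ, (∃ b ∈ K, (∏ i, V.valuation (x i) ^ (m i)) = V.valuation b) → m = 0) ∧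
      (∀ a ∈ F, a ≠ 0 → ∃ n : ℕ, n ≠ 0 ∧ ∃ (m : Fin ρ → ℤ), ∃ b ∈ K,
        V.valuation (a ^ n) = V.valuation b * ∏ i, V.valuation (x i) ^ (m i)) ∧
      AlgebraicIndependent (resField V K) (fun j => residue V ⟨y j, hy j⟩) ∧
      (∀ r ∈ resField V F, IsAlgebraic
        (IntermediateField.adjoin (resField V K) (Set.range fun j => residue V ⟨y j, hy j⟩)) r) ∧
      AlgebraicIndependent K (Sum.elim x y) ∧ ρ + τ ≤ n := by
  classical
  -- the `x` part
  let Px : ℕ → Prop := fun m => ∃ x : Fin m → Ω, (∀ i, x i ∈ F ∧ x i ≠ 0) ∧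
    ∀ e : Fin m → ℤ, (∃ b ∈ K, (∏ i, V.valuation (x i) ^ (e i)) = V.valuation b) → e = 0
  have hri0 : AlgebraicIndependent (resField V K)
      (fun j : Fin 0 => residue V ⟨(Fin.elim0 j : Ω), j.elim0⟩) := by
    rw [algebraicIndependent_empty_type_iff]
    exact (algebraMap (resField V K) (ResidueField V)).injective
  have hPx_bound : ∀ m, Px m → m ≤ n := by
    rintro m ⟨x, hxF, hxi⟩
    have h := algebraicIndependent_sumElim_of_valIndep V K x (Fin.elim0 : Fin 0 → Ω)
      (fun i => (hxF i).2) hxi (fun j => j.elim0) hri0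
    exact hbound m x (fun i => (hxF i).1) (h.comp Sum.inl Sum.inl_injective)
  have hPx0 : Px 0 := ⟨Fin.elim0, fun i => i.elim0, fun e _ => funext fun i => i.elim0⟩
  set ρ := Nat.findGreatest Px n with hρ
  obtain ⟨x, hxF, hxi⟩ : Px ρ := Nat.findGreatest_spec (Nat.zero_le n) hPx0
  have hnotx : ¬ Px (ρ + 1) := fun h =>
    Nat.findGreatest_is_greatest (Nat.lt_succ_self ρ) (hPx_bound _ h) h
  have hx0 : ∀ i, x i ≠ 0 := fun i => (hxF i).2
  have hvx : ∀ i, V.valuation (x i) ≠ 0 := fun i => (map_ne_zero V.valuation).mpr (hx0 i)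
  have hcov : ∀ a ∈ F, a ≠ 0 → ∃ n : ℕ, n ≠ 0 ∧ ∃ (m : Fin ρ → ℤ), ∃ b ∈ K,
      V.valuation (a ^ n) = V.valuation b * ∏ i, V.valuation (x i) ^ (m i) := by
    intro a haF ha0
    have hva : V.valuation a ≠ 0 := (map_ne_zero V.valuation).mpr ha0
    by_contra hno
    push Not at hno
    apply hnotx
    refine ⟨Fin.snoc x a, ?_, ?_⟩
    · intro i
      refine Fin.lastCases ?_ (fun i => ?_) i
      · rw [Fin.snoc_last]; exact ⟨haF, ha0⟩
      · rw [Fin.snoc_castSucc]; exact hxF i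
    · rintro e ⟨b, hb, he⟩
      rw [Fin.prod_univ_castSucc] at he
      simp only [Fin.snoc_castSucc, Fin.snoc_last] at he
      set k := e (Fin.last ρ) with hk
      set P := ∏ i : Fin ρ, V.valuation (x i) ^ e (Fin.castSucc i) with hP
      have hP0 : P ≠ 0 := Finset.prod_ne_zero_iff.mpr fun i _ => zpow_ne_zero _ (hvx i)
      by_cases hk0 : k = 0
      · have h1 : (fun i => e (Fin.castSucc i)) = 0 :=
          hxi _ ⟨b, hb, by rw [← he, hk0, zpow_zero, mul_one]⟩
        funext i
        refine Fin.lastCases hk0 (fun i => ?_) i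
        exact congr_fun h1 i
      · exfalso
        have hkN : k.natAbs ≠ 0 := Int.natAbs_ne_zero.mpr hk0
        rcases Int.natAbs_eq k with hkn | hkn
        · refine hno k.natAbs hkN (fun i => -e (Fin.castSucc i)) b hb ?_
          rw [map_pow, ← zpow_natCast, ← hkn]
          have hprod : (∏ i : Fin ρ, V.valuation (x i) ^ (-e (Fin.castSucc i))) = P⁻¹ := by
            rw [hP, ← Finset.prod_inv_distrib]
            exact Finset.prod_congr rfl fun i _ => zpow_neg _ _
          rw [hprod, ← he, mul_comm P, mul_assoc, mul_inv_cancel₀ hP0, mul_one]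
        · refine hno k.natAbs hkN (fun i => e (Fin.castSucc i)) b⁻¹ (inv_mem hb) ?_
          rw [map_pow, map_inv₀, ← hP]
          have hak : V.valuation a ^ k = (V.valuation a ^ k.natAbs)⁻¹ := by
            conv_lhs => rw [hkn]
            rw [zpow_neg, zpow_natCast]
          rw [hak] at he
          rw [← he, mul_inv, inv_inv, mul_comm P⁻¹, mul_assoc, inv_mul_cancel₀ hP0, mul_one]
  -- the `y` part
  let Py : ℕ → Prop := fun m => ∃ (y : Fin m → Ω) (hy : ∀ j, y j ∈ V), (∀ j, y j ∈ F) ∧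
    AlgebraicIndependent (resField V K) (fun j => residue V ⟨y j, hy j⟩)
  have hxi0 : ∀ e : Fin 0 → ℤ,
      (∃ b ∈ K, (∏ i, V.valuation ((Fin.elim0 : Fin 0 → Ω) i) ^ (e i)) = V.valuation b) →
        e = 0 := fun e _ => funext fun i => i.elim0
  have hPy_bound : ∀ m, Py m → m ≤ n := by
    rintro m ⟨y, hy, hyF, hri⟩
    have h := algebraicIndependent_sumElim_of_valIndep V K (Fin.elim0 : Fin 0 → Ω) y
      (fun i => i.elim0) hxi0 hy hri
    exact hbound m y hyF (h.comp Sum.inr Sum.inr_injective)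
  have hPy0 : Py 0 := ⟨Fin.elim0, fun j => j.elim0, fun j => j.elim0, hri0⟩
  set τ := Nat.findGreatest Py n with hτ
  obtain ⟨y, hy, hyF, hri⟩ : Py τ := Nat.findGreatest_spec (Nat.zero_le n) hPy0
  have hnoty : ¬ Py (τ + 1) := fun h =>
    Nat.findGreatest_is_greatest (Nat.lt_succ_self τ) (hPy_bound _ h) h
  have halg : ∀ r ∈ resField V F, IsAlgebraic
      (IntermediateField.adjoin (resField V K) (Set.range fun j => residue V ⟨y j, hy j⟩)) r := by
    intro r hr
    obtain ⟨a, haF, rfl⟩ := (mem_resField_iff V F r).mp hr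
    rw [IntermediateField.isAlgebraic_adjoin_iff]
    by_contra htr
    apply hnoty
    have hopt : AlgebraicIndependent (resField V K)
        (fun o : Option (Fin τ) => o.elim (residue V a) (fun j => residue V ⟨y j, hy j⟩)) :=
      AlgebraicIndependent.option_iff.mpr ⟨hri, htr⟩
    let y' : Fin (τ + 1) → Ω := Fin.snoc y (a : Ω)
    have hy'last : y' (Fin.last τ) = a := Fin.snoc_last (α := fun _ => Ω) _ _
    have hy'cs : ∀ j, y' (Fin.castSucc j) = y j := fun j =>
      Fin.snoc_castSucc (α := fun _ => Ω) _ _ j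
    have hyV' : ∀ j : Fin (τ + 1), y' j ∈ V := fun j => by
      refine Fin.lastCases ?_ (fun j => ?_) j
      · rw [hy'last]; exact a.2
      · rw [hy'cs]; exact hy j
    refine ⟨y', hyV', fun j => ?_, ?_⟩
    · refine Fin.lastCases ?_ (fun j => ?_) j
      · rw [hy'last]; exact haF
      · rw [hy'cs]; exact hyF j
    · have h := hopt.comp _ finSuccEquivLast.injective
      convert h using 1
      funext j
      refine Fin.lastCases ?_ (fun j => ?_) j
      · simp only [Function.comp_apply, finSuccEquivLast_last, Option.elim]
        congr 1
        exact Subtype.ext hy'last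
      · simp only [Function.comp_apply, finSuccEquivLast_castSucc, Option.elim]
        congr 1
        exact Subtype.ext (hy'cs j)
  -- together
  have hind : AlgebraicIndependent K (Sum.elim x y) :=
    algebraicIndependent_sumElim_of_valIndep V K x y hx0 hxi hy hri
  have hρτ : ρ + τ ≤ n := by
    have h := hind.comp _ finSumFinEquiv.symm.injective
    have hmem : ∀ s : Fin ρ ⊕ Fin τ, Sum.elim x y s ∈ F := by
      rintro (i | j)
      exacts [(hxF i).1, hyF j]
    exact hbound (ρ + τ) _ (fun i => hmem _) h
  exact ⟨ρ, τ, x, y, hy, hxF, hyF, hxi, hcov, hri, halg, hind, hρτ⟩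

end Maximal

/-! ## Part V. Knaf–Kuhlmann 2009, Prop. 2.3 -/

section Prop23

/-- **Prop. 2.3 when `F ⊆ O_V`** (the place is trivial on `F`): take no `xᵢ`, the `yⱼ` a
separating transcendence basis `t₀` of `F|K`, and `t = ∅`; the residue map is an embedding of
`F`. [folklore] -/
theorem prop23_of_subset (V : ValuationSubring Ω) {K F : Subfield Ω} (hKF : K ≤ F)
    (hFV : ∀ z ∈ F, z ∈ V) {t₀ : Finset Ω} (ht₀F : (t₀ : Set Ω) ⊆ F)
    (hind₀ : AlgebraicIndependent K ((↑) : t₀ → Ω))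
    (hsep₀ : ∀ z ∈ F, IsSeparable (IntermediateField.adjoin K (t₀ : Set Ω)) z) :
    ∃ (ρ τ : ℕ) (x : Fin ρ → Ω) (y : Fin τ → Ω) (t : Finset Ω) (hy : ∀ j, y j ∈ V),
      (∀ i, x i ∈ F) ∧ (∀ j, y j ∈ F) ∧ (t : Set Ω) ⊆ F ∧
      AlgebraicIndependent K (Sum.elim (Sum.elim x y) ((↑) : t → Ω)) ∧
      (∀ z ∈ F, IsSeparable
        (IntermediateField.adjoin K (Set.range x ∪ Set.range y ∪ (t : Set Ω))) z) ∧
      (∀ m : Fin ρ → ℤ,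
        (∃ b ∈ K, (∏ i, V.valuation (x i) ^ (m i)) = V.valuation b) → m = 0) ∧
      (∀ a ∈ F, a ≠ 0 → ∃ n : ℕ, n ≠ 0 ∧ ∃ (m : Fin ρ → ℤ), ∃ b ∈ K,
        V.valuation (a ^ n) = V.valuation b * ∏ i, V.valuation (x i) ^ (m i)) ∧
      AlgebraicIndependent (resField V K) (fun j => residue V ⟨y j, hy j⟩) ∧
      ∀ r ∈ resField V F, IsAlgebraic
        (IntermediateField.adjoin (resField V K) (Set.range fun j => residue V ⟨y j, hy j⟩)) r := by
  classical
  set n := t₀.card with hn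
  let e : t₀ ≃ Fin n := t₀.equivFin
  let y : Fin n → Ω := fun j => (e.symm j : Ω)
  have hyF : ∀ j, y j ∈ F := fun j => ht₀F (e.symm j).2
  have hyV : ∀ j, y j ∈ V := fun j => hFV _ (hyF j)
  have hrange : Set.range y = (t₀ : Set Ω) := by
    ext w; constructor
    · rintro ⟨j, rfl⟩; exact (e.symm j).2
    · intro hw; exact ⟨e ⟨w, hw⟩, by simp [y]⟩
  have hyind : AlgebraicIndependent K y := hind₀.comp _ e.symm.injective
  refine ⟨0, n, Fin.elim0, y, ∅, hyV, fun i => i.elim0, hyF, by simp, ?_, ?_, ?_, ?_, ?_, ?_⟩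
  · have hempty : ∀ z : (↥(∅ : Finset Ω)), False := fun z => Finset.notMem_empty _ z.2
    let σ : (Fin 0 ⊕ Fin n) ⊕ (↥(∅ : Finset Ω)) → t₀ :=
      Sum.elim (Sum.elim Fin.elim0 e.symm) (fun z => (hempty z).elim)
    have hσ : Function.Injective σ := by
      rintro ((i | j) | z) ((i' | j') | z')
      · exact i.elim0
      · exact i.elim0
      · exact i.elim0
      · exact i'.elim0
      · intro h
        simp only [σ, Sum.elim_inl, Sum.elim_inr] at h
        rw [e.symm.injective h]
      · exact (hempty z').elim
      · exact (hempty z).elim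
      · exact (hempty z).elim
      · exact (hempty z).elim
    have heq : Sum.elim (Sum.elim Fin.elim0 y) ((↑) : (↥(∅ : Finset Ω)) → Ω) =
        ((↑) : t₀ → Ω) ∘ σ := by
      funext s
      rcases s with ((i | j) | z)
      · exact i.elim0
      · rfl
      · exact (hempty z).elim
    rw [heq]
    exact hind₀.comp σ hσ
  · intro z hz
    refine isSeparable_adjoin_of_subset ?_ (hsep₀ z hz)
    rw [← hrange]
    exact fun w hw => Or.inl (Or.inr hw)
  · intro m _
    funext i; exact i.elim0
  · intro a haF ha0
    refine ⟨1, one_ne_zero, Fin.elim0, 1, K.one_mem, ?_⟩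
    rw [pow_one, map_one, one_mul, valuation_eq_one_of_subfield_subset V hFV haF ha0]
    simp
  · exact algebraicIndependent_residue_of_subset V K hKF hFV y hyF hyind
  · intro r hr
    obtain ⟨a, haF, rfl⟩ := (mem_resField_iff V F r).mp hr
    have halg : IsAlgebraic (IntermediateField.adjoin K (Set.range y)) (a : Ω) :=
      isAlgebraic_adjoin_of_subset (hrange ▸ subset_rfl) (hsep₀ a haF).isIntegral.isAlgebraic
    exact isAlgebraic_residue_of_subset V K hKF hFV y hyF hyind haF halg

/-- **Prop. 2.3 in characteristic `0`**: maximal families `x, y` (algebraically independent by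
Knaf–Kuhlmann 2005, Thm. 2.1) extend to a transcendence basis `x ∪ y ∪ t`, `t ⊆ t₀`, which is
automatically separating. [cite: KnafKuhlmann2009, Prop. 2.3] -/
theorem prop23_charZero [CharZero Ω] (V : ValuationSubring Ω) {K F : Subfield Ω}
    (hfg : FGOver K F) {t₀ : Finset Ω} (ht₀F : (t₀ : Set Ω) ⊆ F)
    (hind₀ : AlgebraicIndependent K ((↑) : t₀ → Ω))
    (hsep₀ : ∀ z ∈ F, IsSeparable (IntermediateField.adjoin K (t₀ : Set Ω)) z) :
    ∃ (ρ τ : ℕ) (x : Fin ρ → Ω) (y : Fin τ → Ω) (t : Finset Ω) (hy : ∀ j, y j ∈ V),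
      (∀ i, x i ∈ F) ∧ (∀ j, y j ∈ F) ∧ (t : Set Ω) ⊆ F ∧
      AlgebraicIndependent K (Sum.elim (Sum.elim x y) ((↑) : t → Ω)) ∧
      (∀ z ∈ F, IsSeparable
        (IntermediateField.adjoin K (Set.range x ∪ Set.range y ∪ (t : Set Ω))) z) ∧
      (∀ m : Fin ρ → ℤ,
        (∃ b ∈ K, (∏ i, V.valuation (x i) ^ (m i)) = V.valuation b) → m = 0) ∧
      (∀ a ∈ F, a ≠ 0 → ∃ n : ℕ, n ≠ 0 ∧ ∃ (m : Fin ρ → ℤ), ∃ b ∈ K,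
        V.valuation (a ^ n) = V.valuation b * ∏ i, V.valuation (x i) ^ (m i)) ∧
      AlgebraicIndependent (resField V K) (fun j => residue V ⟨y j, hy j⟩) ∧
      ∀ r ∈ resField V F, IsAlgebraic
        (IntermediateField.adjoin (resField V K) (Set.range fun j => residue V ⟨y j, hy j⟩)) r := by
  classical
  obtain ⟨M, hMF, hess, b, hbcoe, hb, hsepM, htr, hbound⟩ := exists_bridge hfg ht₀F hind₀ hsep₀
  haveI := hess
  obtain ⟨ρ, τ, x, y, hy, hxF, hyF, hxi, hcov, hri, halg, hind, hρτ⟩ :=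
    exists_maximal_families V (K := K) (F := F) _ hbound
  -- lift `x, y` to `M` and extend to a transcendence basis inside `x ∪ y ∪ t₀`
  have hxyF : ∀ s : Fin ρ ⊕ Fin τ, Sum.elim x y s ∈ F := by
    rintro (i | j)
    exacts [(hxF i).1, hyF j]
  let xyM : Fin ρ ⊕ Fin τ → M := fun s => ⟨Sum.elim x y s, (hMF _).mpr (hxyF s)⟩
  have hxyM : AlgebraicIndependent K xyM := AlgebraicIndependent.of_comp M.val hind
  set s₁ : Set M := Set.range xyM with hs₁
  set t₁ : Set M := s₁ ∪ Set.range b with ht₁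
  have hs₁ind : AlgebraicIndepOn K id s₁ := hxyM.to_subtype_range
  haveI : Algebra.IsAlgebraic (Algebra.adjoin K t₁) M := by
    have h1 : Algebra.IsAlgebraic (Algebra.adjoin K (Set.range b)) M := hb.isAlgebraic
    refine ⟨fun m => (h1.isAlgebraic m).tower_top_of_subalgebra_le (Algebra.adjoin_mono ?_)⟩
    exact Set.subset_union_right
  obtain ⟨u, hsu, hut, hu⟩ :=
    exists_isTranscendenceBasis_between s₁ t₁ Set.subset_union_left hs₁ind
  have hufin : u.Finite := ((Set.finite_range xyM).union (Set.finite_range b)).subset hut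
  let t : Finset Ω := (hufin.toFinset.image (fun m : M => (m : Ω))).filter
    (fun w => w ∉ Set.range x ∪ Set.range y)
  set U : Set Ω := Set.range (fun m : u => ((m : M) : Ω)) with hU
  have hval_u : U ⊆ Set.range x ∪ Set.range y ∪ (t : Set Ω) := by
    rintro _ ⟨m, rfl⟩
    by_cases h : ((m : M) : Ω) ∈ Set.range x ∪ Set.range y
    · exact Or.inl h
    · refine Or.inr ?_
      rw [Finset.mem_coe, Finset.mem_filter]
      exact ⟨Finset.mem_image.mpr ⟨m, hufin.mem_toFinset.mpr m.2, rfl⟩, h⟩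
  have htF : (t : Set Ω) ⊆ F := by
    intro w hw
    rw [Finset.mem_coe, Finset.mem_filter] at hw
    obtain ⟨m, -, rfl⟩ := Finset.mem_image.mp hw.1
    exact (hMF _).mp m.2
  have hf_inj : Function.Injective (Sum.elim (Sum.elim x y) ((↑) : t → Ω)) := by
    refine hind.injective.sumElim Subtype.val_injective ?_
    intro s w h
    apply (Finset.mem_filter.mp w.2).2
    rw [← h]
    rcases s with i | j
    · exact Or.inl ⟨i, rfl⟩
    · exact Or.inr ⟨j, rfl⟩
  have hf_range : Set.range (Sum.elim (Sum.elim x y) ((↑) : t → Ω)) ⊆ U := by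
    rintro _ ⟨s, rfl⟩
    rcases s with s | w
    · exact ⟨⟨xyM s, hsu ⟨s, rfl⟩⟩, rfl⟩
    · obtain ⟨m, hm, hmw⟩ := Finset.mem_image.mp (Finset.mem_filter.mp w.2).1
      exact ⟨⟨m, hufin.mem_toFinset.mp hm⟩, hmw⟩
  have hU_ind : AlgebraicIndependent K ((↑) : U → Ω) := by
    have h1 : AlgebraicIndependent K (fun m : u => ((m : M) : Ω)) :=
      hu.1.map' (f := M.val) fun a b h => Subtype.ext h
    exact h1.to_subtype_range
  have hfind : AlgebraicIndependent K (Sum.elim (Sum.elim x y) ((↑) : t → Ω)) :=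
    (algebraicIndependent_subtype_range hf_inj).mp (hU_ind.mono hf_range)
  -- separability: `M|K(u)` algebraic, hence separable in characteristic `0`
  haveI : CharZero K := K.subtype.charZero
  have hsep : ∀ z ∈ F, IsSeparable
      (IntermediateField.adjoin K (Set.range x ∪ Set.range y ∪ (t : Set Ω))) z := by
    intro z hz
    let m : M := ⟨z, (hMF _).mpr hz⟩
    have h1 : IsAlgebraic (IntermediateField.adjoin K (Set.range fun i : u => (i : M))) m := by
      rw [IntermediateField.isAlgebraic_adjoin_iff]
      exact hu.isAlgebraic.isAlgebraic m
    have h2 : IsSeparable (IntermediateField.adjoin K (Set.range fun i : u => (i : M))) m :=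
      PerfectField.separable_of_irreducible (minpoly.irreducible h1.isIntegral)
    have h3 := isSeparable_adjoin_of_intermediateField M (fun i : u => (i : M)) h2
    exact isSeparable_adjoin_of_subset hval_u h3
  exact ⟨ρ, τ, x, y, t, hy, fun i => (hxF i).1, hyF, htF, hfind, hsep, hxi, hcov, hri, halg⟩

/-- `(γᵐ)ᵖ = (γᵖ)ᵐ` for `m ∈ ℤ`, `p ∈ ℕ`. [folklore] -/
theorem zpow_pow_comm {G : Type*} [DivisionCommMonoid G] (γ : G) (m : ℤ) (p : ℕ) :
    (γ ^ m) ^ p = (γ ^ p) ^ m := by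
  rw [← zpow_natCast (γ ^ m) p, ← zpow_mul, ← zpow_natCast γ p, ← zpow_mul, mul_comm]

/-- **Prop. 2.3 in characteristic `p`, `F ⊄ O_V`.** With `x, y` maximal families, `t₀ = {b_k}`
a separating transcendence basis and `k ↦ e(k)` an injection of the indices of `(x, y)` into
those of `t₀`, put `x'ᵢ := xᵢᵖ + wᵢᵖ b_{e(i)}`, `y'ⱼ := yⱼᵖ + w'ⱼᵖ b_{e(j)}` with `wᵢ, w'ⱼ ≠ 0`
so small that values, resp. residues, are those of `xᵢᵖ`, resp. `yⱼᵖ` (so maximality is kept),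
and `t :=` the unused `b_k`. Since `d(aᵖ) = 0`, `d x'ᵢ = wᵢᵖ d b_{e(i)}` and
`d y'ⱼ = w'ⱼᵖ d b_{e(j)}`: the differentials of `(x', y', t)` span `Ω[F⁄K]`, so `(x', y', t)` is
a separating transcendence basis by the differential criterion. [cite: KnafKuhlmann2009,
Prop. 2.3] -/
theorem prop23_charP (p : ℕ) [hp : Fact p.Prime] [CharP Ω p] (V : ValuationSubring Ω)
    {K F : Subfield Ω} (hfg : FGOver K F) {t₀ : Finset Ω}
    (ht₀F : (t₀ : Set Ω) ⊆ F) (hind₀ : AlgebraicIndependent K ((↑) : t₀ → Ω))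
    (hsep₀ : ∀ z ∈ F, IsSeparable (IntermediateField.adjoin K (t₀ : Set Ω)) z)
    {δ : Ω} (hδF : δ ∈ F) (hδ0 : δ ≠ 0) (hδ : V.valuation δ < 1) :
    ∃ (ρ τ : ℕ) (x : Fin ρ → Ω) (y : Fin τ → Ω) (t : Finset Ω) (hy : ∀ j, y j ∈ V),
      (∀ i, x i ∈ F) ∧ (∀ j, y j ∈ F) ∧ (t : Set Ω) ⊆ F ∧
      AlgebraicIndependent K (Sum.elim (Sum.elim x y) ((↑) : t → Ω)) ∧
      (∀ z ∈ F, IsSeparable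
        (IntermediateField.adjoin K (Set.range x ∪ Set.range y ∪ (t : Set Ω))) z) ∧
      (∀ m : Fin ρ → ℤ,
        (∃ b ∈ K, (∏ i, V.valuation (x i) ^ (m i)) = V.valuation b) → m = 0) ∧
      (∀ a ∈ F, a ≠ 0 → ∃ n : ℕ, n ≠ 0 ∧ ∃ (m : Fin ρ → ℤ), ∃ b ∈ K,
        V.valuation (a ^ n) = V.valuation b * ∏ i, V.valuation (x i) ^ (m i)) ∧
      AlgebraicIndependent (resField V K) (fun j => residue V ⟨y j, hy j⟩) ∧
      ∀ r ∈ resField V F, IsAlgebraic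
        (IntermediateField.adjoin (resField V K) (Set.range fun j => residue V ⟨y j, hy j⟩)) r := by
  classical
  have hp0 : p ≠ 0 := hp.out.ne_zero
  have hppos : 0 < p := hp.out.pos
  obtain ⟨M, hMF, hess, b, hbcoe, hb, hsepM, htr, hbound⟩ := exists_bridge hfg ht₀F hind₀ hsep₀
  haveI := hess
  obtain ⟨ρ, τ, x, y, hy, hxF, hyF, hxi, hcov, hri, halg, hind, hρτ⟩ :=
    exists_maximal_families V (K := K) (F := F) _ hbound
  have hx0 : ∀ i, x i ≠ 0 := fun i => (hxF i).2
  have hb0 : ∀ k : t₀, (k : Ω) ≠ 0 := fun k => hind₀.ne_zero k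
  -- an injection of the indices of `(x, y)` into `t₀`
  have hcard : Fintype.card (Fin ρ ⊕ Fin τ) ≤ Fintype.card t₀ := by simpa using hρτ
  obtain ⟨e⟩ := Function.Embedding.nonempty_of_card_le hcard
  -- small perturbations
  have hsmall := fun (β θ : Ω) (hβ : β ∈ F) (hθ : θ ∈ F) (hθ0 : θ ≠ 0) =>
    exists_valuation_pow_mul_lt V hδF hδ0 hδ p hp0 hβ hθ hθ0
  choose w hwF hw0 hwlt using fun i : Fin ρ =>
    hsmall (e (Sum.inl i) : Ω) (x i ^ p) (ht₀F (e (Sum.inl i)).2) (pow_mem (hxF i).1 p)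
      (pow_ne_zero _ (hx0 i))
  choose w' hw'F hw'0 hw'lt using fun j : Fin τ =>
    hsmall (e (Sum.inr j) : Ω) 1 (ht₀F (e (Sum.inr j)).2) F.one_mem one_ne_zero
  -- the new elements, in `M`
  let xM : Fin ρ → M := fun i => ⟨x i, (hMF _).mpr (hxF i).1⟩
  let yM : Fin τ → M := fun j => ⟨y j, (hMF _).mpr (hyF j)⟩
  let wM : Fin ρ → M := fun i => ⟨w i, (hMF _).mpr (hwF i)⟩
  let wM' : Fin τ → M := fun j => ⟨w' j, (hMF _).mpr (hw'F j)⟩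
  let x'M : Fin ρ → M := fun i => xM i ^ p + wM i ^ p * b (e (Sum.inl i))
  let y'M : Fin τ → M := fun j => yM j ^ p + wM' j ^ p * b (e (Sum.inr j))
  let cM : t₀ → M := Function.extend e (Sum.elim x'M y'M) b
  have hcM_e : ∀ s, cM (e s) = Sum.elim x'M y'M s := fun s =>
    e.injective.extend_apply _ _ s
  have hcM_ne : ∀ k, (¬ ∃ s, e s = k) → cM k = b k := fun k hk =>
    Function.extend_apply' _ _ _ hk
  -- … and in `Ω`
  let x' : Fin ρ → Ω := fun i => x i ^ p + w i ^ p * (e (Sum.inl i) : Ω)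
  let y' : Fin τ → Ω := fun j => y j ^ p + w' j ^ p * (e (Sum.inr j) : Ω)
  have hx'c : ∀ i, (x'M i : Ω) = x' i := fun i => by
    simp [x'M, x', xM, wM, hbcoe]
  have hy'c : ∀ j, (y'M j : Ω) = y' j := fun j => by
    simp [y'M, y', yM, wM', hbcoe]
  -- differentials: `d(cM k)` is a unit multiple of `d(b k)`
  have hDp : ∀ m : M, D K M (m ^ p) = 0 := fun m => by
    rw [Derivation.leibniz_pow, ← Nat.cast_smul_eq_nsmul M, CharP.cast_eq_zero M p, zero_smul]
  have hDc : ∀ k, ∃ μ : M, μ ≠ 0 ∧ D K M (cM k) = μ • D K M (b k) := by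
    intro k
    by_cases hk : ∃ s, e s = k
    · obtain ⟨s, rfl⟩ := hk
      rw [hcM_e]
      rcases s with i | j
      · refine ⟨wM i ^ p, pow_ne_zero _ (fun h => hw0 i (congrArg Subtype.val h)), ?_⟩
        simp only [Sum.elim_inl, x'M, map_add, Derivation.leibniz, hDp, smul_zero, add_zero,
          zero_add]
      · refine ⟨wM' j ^ p, pow_ne_zero _ (fun h => hw'0 j (congrArg Subtype.val h)), ?_⟩
        simp only [Sum.elim_inr, y'M, map_add, Derivation.leibniz, hDp, smul_zero, add_zero,
          zero_add]
    · exact ⟨1, one_ne_zero, by rw [hcM_ne k hk, one_smul]⟩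
  have hspan : Submodule.span M (Set.range fun k => D K M (cM k)) = ⊤ := by
    haveI : Algebra.IsSeparable (IntermediateField.adjoin K (Set.range b)) M := ⟨hsepM⟩
    rw [eq_top_iff, ← span_range_D_eq_top b, Submodule.span_le]
    rintro _ ⟨k, rfl⟩
    obtain ⟨μ, hμ, hk⟩ := hDc k
    have : D K M (b k) = μ⁻¹ • D K M (cM k) := by
      rw [hk, smul_smul, inv_mul_cancel₀ hμ, one_smul]
    change D K M (b k) ∈ _
    rw [this]
    exact Submodule.smul_mem _ _ (Submodule.subset_span ⟨k, rfl⟩)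
  have hcT : IsTranscendenceBasis K cM :=
    isTranscendenceBasis_of_span_range_D_eq_top cM hspan (by
      rw [htr, Cardinal.mk_fintype, Fintype.card_coe])
  have hsepc : Algebra.IsSeparable (IntermediateField.adjoin K (Set.range cM)) M :=
    isSeparable_adjoin_of_span_range_D_eq_top cM hspan
  -- the new family in `Ω`: `(x', y', t)`
  let t : Finset Ω := t₀.filter (fun z => z ∉ Set.range fun s => (e s : Ω))
  have htF : (t : Set Ω) ⊆ F := fun z hz => ht₀F (Finset.mem_filter.mp hz).1
  have hsmallV : ∀ j, w' j ^ p * (e (Sum.inr j) : Ω) ∈ V := fun j =>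
    (V.valuation_le_one_iff _).mp (le_of_lt ((hw'lt j).trans_eq (map_one _)))
  have hy'V : ∀ j, y' j ∈ V := fun j => add_mem (pow_mem (hy j) p) (hsmallV j)
  -- (4) algebraic independence
  have hcΩ : AlgebraicIndependent K (fun k => (cM k : Ω)) :=
    hcT.1.map' (f := M.val) fun a b h => Subtype.ext h
  let σ : (Fin ρ ⊕ Fin τ) ⊕ ↥t → t₀ := Sum.elim e (fun z => ⟨z, (Finset.mem_filter.mp z.2).1⟩)
  have hσt : ∀ z : t, ¬ ∃ s, e s = σ (Sum.inr z) := by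
    rintro z ⟨s, hs⟩
    exact (Finset.mem_filter.mp z.2).2 ⟨s, congrArg Subtype.val hs⟩
  have hσ : Function.Injective σ := by
    refine e.injective.sumElim (fun a b h => Subtype.ext ?_) (fun s z h => hσt z ⟨s, h⟩)
    exact (congrArg Subtype.val h :)
  have hfam : Sum.elim (Sum.elim x' y') ((↑) : t → Ω) = (fun k => (cM k : Ω)) ∘ σ := by
    funext s
    rcases s with (i | j) | z
    · simp only [Sum.elim_inl, Function.comp_apply, σ, hcM_e, hx'c]
    · simp only [Sum.elim_inl, Sum.elim_inr, Function.comp_apply, σ, hcM_e, hy'c]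
    · change (z : Ω) = (cM (σ (Sum.inr z)) : Ω)
      rw [hcM_ne _ (hσt z), hbcoe]
      rfl
  have hfind : AlgebraicIndependent K (Sum.elim (Sum.elim x' y') ((↑) : t → Ω)) := by
    rw [hfam]
    exact hcΩ.comp σ hσ
  -- (5) separability
  have hrange : Set.range (fun k => (cM k : Ω)) ⊆ Set.range x' ∪ Set.range y' ∪ (t : Set Ω) := by
    rintro _ ⟨k, rfl⟩
    change (cM k : Ω) ∈ _
    by_cases hk : ∃ s, e s = k
    · obtain ⟨s, rfl⟩ := hk
      rw [hcM_e]
      rcases s with i | j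
      · exact Or.inl (Or.inl ⟨i, (hx'c i).symm⟩)
      · exact Or.inl (Or.inr ⟨j, (hy'c j).symm⟩)
    · rw [hcM_ne k hk, hbcoe]
      refine Or.inr (Finset.mem_filter.mpr ⟨k.2, ?_⟩)
      rintro ⟨s, hs⟩
      exact hk ⟨s, Subtype.ext hs⟩
  have hsep : ∀ z ∈ F, IsSeparable
      (IntermediateField.adjoin K (Set.range x' ∪ Set.range y' ∪ (t : Set Ω))) z := by
    intro z hz
    have h1 : IsSeparable (IntermediateField.adjoin K (Set.range cM)) (⟨z, (hMF _).mpr hz⟩ : M) :=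
      Algebra.IsSeparable.isSeparable _ _
    have h2 := isSeparable_adjoin_of_intermediateField M cM h1
    exact isSeparable_adjoin_of_subset hrange h2
  -- (6), (7): the values of the `x'ᵢ` are those of the `xᵢᵖ`
  have hvx' : ∀ i, V.valuation (x' i) = V.valuation (x i) ^ p := fun i => by
    simp only [x']
    rw [Valuation.map_add_eq_of_lt_left _ (hwlt i), map_pow]
  have hxi' : ∀ m : Fin ρ → ℤ,
      (∃ c ∈ K, (∏ i, V.valuation (x' i) ^ (m i)) = V.valuation c) → m = 0 := by
    rintro m ⟨c, hc, hm⟩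
    have h := hxi (fun i => (p : ℤ) * m i) ⟨c, hc, ?_⟩
    · funext i
      have hi := congr_fun h i
      simp only [Pi.zero_apply, mul_eq_zero, Nat.cast_eq_zero, hp0, false_or] at hi
      exact hi
    · rw [← hm]
      refine Finset.prod_congr rfl fun i _ => ?_
      rw [hvx', zpow_mul, zpow_natCast]
  have hcov' : ∀ a ∈ F, a ≠ 0 → ∃ n : ℕ, n ≠ 0 ∧ ∃ (m : Fin ρ → ℤ), ∃ c ∈ K,
      V.valuation (a ^ n) = V.valuation c * ∏ i, V.valuation (x' i) ^ (m i) := by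
    intro a haF ha0
    obtain ⟨n, hn, m, c, hc, h⟩ := hcov a haF ha0
    refine ⟨n * p, mul_ne_zero hn hp0, m, c ^ p, pow_mem hc p, ?_⟩
    rw [pow_mul, map_pow, h, mul_pow, map_pow, ← Finset.prod_pow]
    congr 1
    refine Finset.prod_congr rfl fun i _ => ?_
    rw [hvx', zpow_pow_comm]
  -- (8), (9): the residues of the `y'ⱼ` are those of the `yⱼᵖ`
  have hres : ∀ j, residue V ⟨y' j, hy'V j⟩ = residue V ⟨y j, hy j⟩ ^ p := by
    intro j
    have heq : (⟨y' j, hy'V j⟩ : V) = ⟨y j, hy j⟩ ^ p + ⟨_, hsmallV j⟩ := Subtype.ext (by simp [y'])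
    have h0 : residue V ⟨_, hsmallV j⟩ = 0 :=
      (residue_eq_zero_iff _).mpr ((V.valuation_lt_one_iff _).mpr ((hw'lt j).trans_eq (map_one _)))
    rw [heq, map_add, map_pow, h0, add_zero]
  have hfun : (fun j => residue V ⟨y' j, hy'V j⟩) = fun j => residue V ⟨y j, hy j⟩ ^ p :=
    funext hres
  have hri' : AlgebraicIndependent (resField V K) (fun j => residue V ⟨y' j, hy'V j⟩) := by
    rw [hfun, algebraicIndependent_iff]
    intro q hq
    have hq' : MvPolynomial.aeval (fun j => residue V ⟨y j, hy j⟩) (MvPolynomial.expand p q) = 0 := by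
      rw [MvPolynomial.aeval_expand]
      exact hq
    exact (MvPolynomial.expand_eq_zero hppos).mp (hri.eq_zero_of_aeval_eq_zero _ hq')
  have halg' : ∀ r ∈ resField V F, IsAlgebraic
      (IntermediateField.adjoin (resField V K) (Set.range fun j => residue V ⟨y' j, hy'V j⟩)) r := by
    intro r hr
    rw [hfun]
    exact isAlgebraic_adjoin_pow (fun j => residue V ⟨y j, hy j⟩) hppos (halg r hr)
  refine ⟨ρ, τ, x', y', t, hy'V, fun i => ?_, fun j => ?_, htF, hfind, hsep, hxi', hcov', hri',
    halg'⟩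
  · exact add_mem (pow_mem (hxF i).1 p) (mul_mem (pow_mem (hwF i) p) (ht₀F (e _).2))
  · exact add_mem (pow_mem (hyF j) p) (mul_mem (pow_mem (hw'F j) p) (ht₀F (e _).2))

/-- **Knaf–Kuhlmann 2009, Prop. 2.3** — PROVED: the named fact `KnafKuhlmann2009_Prop23`
holds. (Characteristic `0`: `prop23_charZero`; characteristic `p` and `F ⊆ O_V`:
`prop23_of_subset`; characteristic `p` and `F ⊄ O_V`: `prop23_charP` with `δ := a⁻¹` for some
`a ∈ F ∖ O_V`.) [cite: KnafKuhlmann2009, Prop. 2.3] -/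
theorem KnafKuhlmann2009_Prop23_holds : KnafKuhlmann2009_Prop23.{u} := by
  intro Ω _ V K F hKF hfg hsg
  obtain ⟨t₀, ht₀F, hind₀, hsep₀⟩ := hsg
  obtain ⟨p, hchar⟩ := ExpChar.exists Ω
  rcases hchar with _ | ⟨hprime⟩
  · exact prop23_charZero V hfg ht₀F hind₀ hsep₀
  · haveI := Fact.mk hprime
    by_cases hFV : ∀ z ∈ F, z ∈ V
    · exact prop23_of_subset V hKF hFV ht₀F hind₀ hsep₀
    · push Not at hFV
      obtain ⟨a, haF, haV⟩ := hFV
      have hva : 1 < V.valuation a :=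
        lt_of_not_ge fun h => haV ((V.valuation_le_one_iff a).mp h)
      have ha0 : a ≠ 0 := by
        rintro rfl
        exact haV (zero_mem V)
      refine prop23_charP p V hfg ht₀F hind₀ hsep₀ (inv_mem haF) (inv_ne_zero ha0) ?_
      rw [map_inv₀]
      exact (inv_lt_one₀ (zero_lt_one.trans hva)).mpr hva

/-- **Knaf–Kuhlmann 2009, Thm. 1.2 (type-level rendering) from Thm. 1.1 and Knaf–Kuhlmann
2005, Thm. 1.1**: the assembly `KnafKuhlmann2009_Thm12.of_parts` with Prop. 2.3 discharged by
`KnafKuhlmann2009_Prop23_holds`. [cite: KnafKuhlmann2009, Thm. 1.2 and §4.2] -/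
theorem KnafKuhlmann2009_Thm12.of_parts' (h11 : KnafKuhlmann2009_Thm11.{u})
    (h05 : KnafKuhlmann2005_Thm11.{u}) : KnafKuhlmann2009_Thm12.{u} :=
  KnafKuhlmann2009_Thm12.of_parts h11 KnafKuhlmann2009_Prop23_holds h05

/-- **The fact `KnafKuhlmann2009` from Knaf–Kuhlmann 2009, Thm. 1.1 and Knaf–Kuhlmann 2005,
Thm. 1.1** (all other ingredients of the printed proof of Thm. 1.2 — Prop. 2.3, Prop. 3.2,
Prop. 3.4 (2), KK05 Thm. 2.1 and Cor. 2.2, smooth ⇒ regular — are proved in this topic).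
[cite: KnafKuhlmann2009, Thm. 1.2] -/
theorem KnafKuhlmann2009.of_parts' (h11 : KnafKuhlmann2009_Thm11.{u})
    (h05 : KnafKuhlmann2005_Thm11.{u}) : KnafKuhlmann2009.{u} :=
  KnafKuhlmann2009.of_parts h11 KnafKuhlmann2009_Prop23_holds h05

end Prop23

end Literature.AlgebraicGeometry.Resolution

end
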